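import Literature.Probability.LatticeModels.CriticalTwoPointLower
import HarnessLib

/-!
# Messager–Miracle-Solé comparison in the sup norm (Aizenman–Duminil-Copin 2021, eq. (5.3))

Topic `Literature/Probability/LatticeModels`; family `crit-ising`. From the tree's theorems
`messager_miracleSole_holds`, `messager_miracleSole_diag_holds` (`MessagerMiracleSole`),
`twoPointPlus_reflection_invariant_holds`, `twoPointPlus_perm_invariant_holds`
(`CriticalTwoPointLower`) and the two halves of Duminil-Copin's eq. (4.10) derived from them in
`SharpnessProofs` (`twoPointPlus_le_axis_of_mem_sphere`: `S(y) ≤ S(n e₁)` for `‖y‖_∞ = n`;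
`twoPointPlus_diagAxis_le_of_mem_sphere`: `S(d n e₁) ≤ S(y)`; `twoPointPlus_add_single_le`:
monotonicity along an axis), this file records the comparison principle in the form printed
in

* M. Aizenman, H. Duminil-Copin, Ann. of Math. 194 (2021) = arXiv:1912.07973, §5.1, the display
  after Proposition 5.1 (MMS monotonicity), "(eq:MMS3)": "for any `x, y ∈ ℤ^d` with
  `‖y‖_∞ ≥ d ‖x‖_∞`, `S_{ρ,β}(x) ≥ S_{ρ,β}(y)`",

for the plus-state two-point function `S = ⟨σ₀σ_·⟩⁺_{β,0} = twoPointPlus d β` of the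
nearest-neighbour Ising model, `β ≥ 0` (`twoPointPlus_le_of_mul_supNorm_le`), together with the
averaged form used in §5.3 (first inequality of (5.24)) and §6.3 (bound on (2)) of that paper:
`|Λ_m| S(v) ≤ ∑_{y ∈ Λ_m} S(y)` whenever `d m ≤ ‖v‖_∞` (`card_box_mul_twoPointPlus_le_sum_box`).

## Mathlib

`Pi.single`; the tree's `Site.supNorm`, `sphere`, `box`.
-/

noncomputable section

open Finset

namespace Literature.Probability.LatticeModels

variable {d : ℕ}

/-- **Aizenman–Duminil-Copin 2021, eq. (5.3) (MMS comparison in the sup norm).** For the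
plus-state two-point function `S = ⟨σ₀σ_·⟩⁺_{β,0}` of the nearest-neighbour Ising model on `ℤ^d`,
`β ≥ 0`: "for any `x, y ∈ ℤ^d` with `‖y‖_∞ ≥ d ‖x‖_∞`, `S(x) ≥ S(y)`", "since
`‖x‖₁ ≤ d ‖x‖_∞ ≤ ‖y‖_∞`, by (5.2) the two quantities are on the correspondingly opposite sides
of `S((‖x‖₁, 0_⊥))`" (arXiv:1912.07973, §5.1, display after Prop. 5.1). Here from the two
halves of Duminil-Copin 2019, eq. (4.10), proved in `SharpnessProofs`:
`S(y) ≤ S(‖y‖_∞ e₁) ≤ S(d ‖x‖_∞ e₁) ≤ S(x)`. [cite: AizenmanDuminilCopinAnnals2021, arXiv:1912.07973 §5.1, eq. (5.3) (display after Prop. 5.1)] [cite: DuminilCopin2019, Exercise 37 (4), eq. (4.10), §4.3] -/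
theorem twoPointPlus_le_of_mul_supNorm_le {β : ℝ} (hβ : 0 ≤ β) {x y : Site d}
    (h : d * Site.supNorm x ≤ Site.supNorm y) : twoPointPlus d β y ≤ twoPointPlus d β x := by
  rcases Nat.eq_zero_or_pos d with hd | hd
  · subst hd
    have hx : x = 0 := funext fun i => Fin.elim0 i
    have hy : y = 0 := funext fun i => Fin.elim0 i
    rw [hx, hy]
  have hd1 : 1 ≤ d := hd
  have hMMS : ∀ {β : ℝ}, messager_miracleSole (d := d) (β := β) := fun {β} =>
    messager_miracleSole_holds (d := d) (β := β)
  have hMMSd : ∀ {β : ℝ}, messager_miracleSole_diag (d := d) (β := β) := fun {β} =>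
    messager_miracleSole_diag_holds (d := d) (β := β)
  have h1 := twoPointPlus_le_axis_of_mem_sphere hMMS twoPointPlus_reflection_invariant_holds
    twoPointPlus_perm_invariant_holds hβ hd1 (self_mem_sphere y)
  have h3 := twoPointPlus_diagAxis_le_of_mem_sphere hMMS hMMSd
    twoPointPlus_reflection_invariant_holds twoPointPlus_perm_invariant_holds hβ hd1
    (self_mem_sphere x)
  have h2 : twoPointPlus d β (Pi.single (⟨0, hd1⟩ : Fin d) (Site.supNorm y : ℤ)) ≤
      twoPointPlus d β (Pi.single (⟨0, hd1⟩ : Fin d) ((d : ℤ) * Site.supNorm x)) := by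
    have hle : (d : ℤ) * Site.supNorm x ≤ Site.supNorm y := by exact_mod_cast h
    have key := twoPointPlus_add_single_le hMMS hβ
      (Pi.single (⟨0, hd1⟩ : Fin d) ((d : ℤ) * Site.supNorm x)) ⟨0, hd1⟩ (by simp; positivity)
      ((Site.supNorm y : ℤ) - (d : ℤ) * Site.supNorm x).toNat
    rwa [← Pi.single_add, Int.toNat_of_nonneg (by omega), add_sub_cancel] at key
  exact h1.trans (h2.trans h3)

/-- **Averaged form** (as used in Aizenman–Duminil-Copin 2021, §5.3, first inequality of the
display after the proof of Thm 5.6, and §6.3, bound on (2)): if `d m ≤ ‖v‖_∞` then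
`S(v) ≤ S(y)` for every `y ∈ Λ_m`, hence `|Λ_m| S(v) ≤ ∑_{y ∈ Λ_m} S(y)`. [cite: AizenmanDuminilCopinAnnals2021, arXiv:1912.07973 §5.3, display after the proof of Thm 5.6 (p. 19), first inequality] -/
theorem card_box_mul_twoPointPlus_le_sum_box {β : ℝ} (hβ : 0 ≤ β) {v : Site d} {m : ℕ}
    (h : d * m ≤ Site.supNorm v) :
    (#(box d m) : ℝ) * twoPointPlus d β v ≤ ∑ y ∈ box d m, twoPointPlus d β y := by
  calc (#(box d m) : ℝ) * twoPointPlus d β v = ∑ _y ∈ box d m, twoPointPlus d β v := by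
        rw [Finset.sum_const, nsmul_eq_mul]
    _ ≤ ∑ y ∈ box d m, twoPointPlus d β y := Finset.sum_le_sum fun y hy => by
        refine twoPointPlus_le_of_mul_supNorm_le hβ ((Nat.mul_le_mul_left d ?_).trans h)
        exact mem_box_iff_supNorm_le.1 hy

end Literature.Probability.LatticeModels
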